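import Summits.ABC.StewartYu.PadicG3TwoSizesThird
import HarnessLib

/-!
# Cell abc-stewartyu, Gen-3 frame at `p = 2` (crux `Y07Two`, stmt-ABC-19659), record interface: the BOXES, the
# far-height units, the directional bound and `#box` of the schedule of record in the letters `L`, `Aⱼ`, `bⱼ`

`Summits/ABC/StewartYu/PadicG3TwoSizesAux.lean` — cell `abc-stewartyu` (HOME `run/shared/lean/pub/abc-stewartyu/`),
route `PadicPrimesKummerThird`, seat p5 (g3); sequel to `PadicG3TwoSizes(Third)`.  Theorems only, elementary real
bounds (`Aⱼ ≥ log 2` from `PadicG3Par.hA`):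
* `Dbox3_zero_real_le` / `Dθ3_zero_real_le` : `Dbox3 0 j ≤ L/(2Aⱼ) + 1`; `Dbox3R_real_le` / `Dθ3R_real_le` :
  `Dbox3R I j ≤ 2(L/(2Aⱼ)+1)/3^I`;
* `hboxR_le` : `hboxR I ≤ (2/3^I)·(∑ⱼ (L/(2Aⱼ)+1)·h(αⱼ) + (L/(2A_θ)+1)·h(θ))`, and under `h(αⱼ) ≤ Aⱼ`, `h(θ) ≤ A_θ`:
  `hboxR_le_of_heights : hboxR I ≤ (2/3^I)·((d+1)·L/2 + ∑ⱼAⱼ + A_θ)` (Nesterenko (4.35): `≍ nL/3^I`);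
* `Xb3R_real_le` : `Xb3R I ≤ 1 + (|b_θ|·d + ∑ⱼ|bⱼ|)·(L/log 2 + 2)`;
* `log_cardB_schedTwoS_le` : `log #box ≤ log(L₀+1) + (d+1)·log(L/log 2 + 3)`.
(`log ν(H) ≤ (23/20)·H` is lit's `PiTranscendenceMeasureMain.log_lcmUpto_le`.)

WHAT THIS IS NOT: budget comparisons; no crux moves.

References: Yu. V. Nesterenko, LNM 1819 (2003), §4.2 (4.23), §4.3 (4.35).
-/

noncomputable section

open Finset Real
open Literature.NumberTheory.Transcendental

namespace Summit.ABC.StewartYu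

namespace TwoSetup

open Summit.ABC.StewartYu.G3Boxes

variable (S : TwoSetup) (P : PadicG3Par (S.d + 1))

/-! ### The boxes in the letters `L`, `Aⱼ` -/

/-- `0 < Aⱼ`. [folklore] -/
theorem A_pos (k : Fin (S.d + 1)) : 0 < P.A k :=
  lt_of_lt_of_le (Real.log_pos (by norm_num)) (P.hA k)

/-- `Dbox3 0 j ≤ L/(2Aⱼ) + 1`. [folklore] -/
theorem Dbox3_zero_real_le (j : Fin S.d) :
    (S.Dbox3 P 0 j : ℝ) ≤ (P.L : ℝ) / (2 * P.A (Fin.castSucc j)) + 1 := by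
  unfold Dbox3
  rw [pow_zero, Nat.div_one]
  push_cast
  have h := Nat.floor_le (show (0 : ℝ) ≤ (P.L : ℝ) / (2 * P.A (Fin.castSucc j)) by
    have := S.A_pos P (Fin.castSucc j); positivity)
  linarith

/-- `Dθ3 0 ≤ L/(2A_θ) + 1`. [folklore] -/
theorem Dθ3_zero_real_le : (S.Dθ3 P 0 : ℝ) ≤ (P.L : ℝ) / (2 * P.A (Fin.last S.d)) + 1 := by
  unfold Dθ3
  rw [pow_zero, Nat.div_one]
  push_cast
  have h := Nat.floor_le (show (0 : ℝ) ≤ (P.L : ℝ) / (2 * P.A (Fin.last S.d)) by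
    have := S.A_pos P (Fin.last S.d); positivity)
  linarith

/-- `Dbox3R I j ≤ 2(L/(2Aⱼ)+1)/3^I` (all `I`). [cite: Nesterenko2003, §4.3 (4.35); shape only] -/
theorem Dbox3R_real_le (I : ℕ) (j : Fin S.d) :
    (S.Dbox3R P I j : ℝ) ≤ 2 * ((P.L : ℝ) / (2 * P.A (Fin.castSucc j)) + 1) / 3 ^ I := by
  have h0 := S.Dbox3_zero_real_le P j
  have hpos : (0 : ℝ) < 3 ^ I := by positivity
  unfold Dbox3R
  split_ifs with hI
  · subst hI
    rw [pow_zero, div_one]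
    have : (0 : ℝ) ≤ (S.Dbox3 P 0 j : ℝ) := by positivity
    linarith
  · have h := Nat.cast_div_le (α := ℝ) (m := 2 * S.Dbox3 P 0 j) (n := 3 ^ I)
    push_cast at h
    refine h.trans ?_
    rw [div_le_div_iff_of_pos_right hpos]
    linarith

/-- `Dθ3R I ≤ 2(L/(2A_θ)+1)/3^I` (all `I`). [cite: Nesterenko2003, §4.3 (4.35); shape only] -/
theorem Dθ3R_real_le (I : ℕ) :
    (S.Dθ3R P I : ℝ) ≤ 2 * ((P.L : ℝ) / (2 * P.A (Fin.last S.d)) + 1) / 3 ^ I := by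
  have h0 := S.Dθ3_zero_real_le P
  have hpos : (0 : ℝ) < 3 ^ I := by positivity
  unfold Dθ3R
  split_ifs with hI
  · subst hI
    rw [pow_zero, div_one]
    have : (0 : ℝ) ≤ (S.Dθ3 P 0 : ℝ) := by positivity
    linarith
  · have h := Nat.cast_div_le (α := ℝ) (m := 2 * S.Dθ3 P 0) (n := 3 ^ I)
    push_cast at h
    refine h.trans ?_
    rw [div_le_div_iff_of_pos_right hpos]
    linarith

/-! ### The far-height unit -/

/-- **`hboxR I ≤ (2/3^I)·(∑ⱼ (L/(2Aⱼ)+1)·h(αⱼ) + (L/(2A_θ)+1)·h(θ))`.** [cite: Nesterenko2003, §4.3 (4.35); shape only] -/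
theorem hboxR_le (I : ℕ) :
    S.hboxR P I ≤ 2 / 3 ^ I * (∑ j, ((P.L : ℝ) / (2 * P.A (Fin.castSucc j)) + 1) * Height.logHeight₁ (S.α j) +
      ((P.L : ℝ) / (2 * P.A (Fin.last S.d)) + 1) * Height.logHeight₁ S.θ) := by
  unfold hboxR
  have hα : ∀ j, 0 ≤ Height.logHeight₁ (S.α j) := fun j => Height.zero_le_logHeight₁ _
  have hθ : 0 ≤ Height.logHeight₁ S.θ := Height.zero_le_logHeight₁ _
  have h1 : ∑ j, (S.Dbox3R P I j : ℝ) * Height.logHeight₁ (S.α j) ≤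
      ∑ j, (2 * ((P.L : ℝ) / (2 * P.A (Fin.castSucc j)) + 1) / 3 ^ I) * Height.logHeight₁ (S.α j) :=
    Finset.sum_le_sum fun j _ => mul_le_mul_of_nonneg_right (S.Dbox3R_real_le P I j) (hα j)
  have h2 : (S.Dθ3R P I : ℝ) * Height.logHeight₁ S.θ ≤
      (2 * ((P.L : ℝ) / (2 * P.A (Fin.last S.d)) + 1) / 3 ^ I) * Height.logHeight₁ S.θ :=
    mul_le_mul_of_nonneg_right (S.Dθ3R_real_le P I) hθ
  refine (add_le_add h1 h2).trans (le_of_eq ?_)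
  have e : ∀ j : Fin S.d, (2 * ((P.L : ℝ) / (2 * P.A (Fin.castSucc j)) + 1) / 3 ^ I) * Height.logHeight₁ (S.α j)
      = 2 / 3 ^ I * ((((P.L : ℝ) / (2 * P.A (Fin.castSucc j)) + 1)) * Height.logHeight₁ (S.α j)) :=
    fun j => by ring
  simp_rw [e]
  rw [← Finset.mul_sum]
  ring

/-- **Under `h(αⱼ) ≤ Aⱼ`, `h(θ) ≤ A_θ`: `hboxR I ≤ (2/3^I)·((d+1)·L/2 + ∑ⱼAⱼ + A_θ)`** (`≍ nL/3^I`).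
[cite: Nesterenko2003, §4.3 (4.35); shape only] -/
theorem hboxR_le_of_heights (I : ℕ) (hVα : ∀ j, Height.logHeight₁ (S.α j) ≤ P.A (Fin.castSucc j))
    (hVθ : Height.logHeight₁ S.θ ≤ P.A (Fin.last S.d)) :
    S.hboxR P I ≤ 2 / 3 ^ I * ((S.d + 1) * (P.L : ℝ) / 2 + ∑ j, P.A (Fin.castSucc j) + P.A (Fin.last S.d)) := by
  refine (S.hboxR_le P I).trans (mul_le_mul_of_nonneg_left ?_ (by positivity))
  have hα : ∀ j, 0 ≤ Height.logHeight₁ (S.α j) := fun j => Height.zero_le_logHeight₁ _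
  have hθ : 0 ≤ Height.logHeight₁ S.θ := Height.zero_le_logHeight₁ _
  -- each term: `(L/(2A)+1)·h ≤ (L/(2A))·A + A = L/2 + A` using `h ≤ A`
  have ht : ∀ (A h : ℝ), 0 < A → 0 ≤ h → h ≤ A → ((P.L : ℝ) / (2 * A) + 1) * h ≤ (P.L : ℝ) / 2 + A := by
    intro A h hA h0 hhA
    have hL : (0 : ℝ) ≤ P.L := by positivity
    have e : (P.L : ℝ) / (2 * A) * A = (P.L : ℝ) / 2 := by field_simp
    calc ((P.L : ℝ) / (2 * A) + 1) * h ≤ ((P.L : ℝ) / (2 * A) + 1) * A := by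
          exact mul_le_mul_of_nonneg_left hhA (by positivity)
      _ = (P.L : ℝ) / 2 + A := by rw [add_mul, e, one_mul]
  have h1 : ∑ j, ((P.L : ℝ) / (2 * P.A (Fin.castSucc j)) + 1) * Height.logHeight₁ (S.α j) ≤
      ∑ j : Fin S.d, ((P.L : ℝ) / 2 + P.A (Fin.castSucc j)) :=
    Finset.sum_le_sum fun j _ => ht _ _ (S.A_pos P _) (hα j) (hVα j)
  have h2 := ht _ _ (S.A_pos P (Fin.last S.d)) hθ hVθ
  rw [Finset.sum_add_distrib, Finset.sum_const, Finset.card_univ, Fintype.card_fin, nsmul_eq_mul] at h1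
  have hL : (0 : ℝ) ≤ P.L := by positivity
  nlinarith [h1, h2]

/-! ### The directional bound and `#box` -/

/-- **`Xb3R I ≤ 1 + (|b_θ|·d + ∑ⱼ|bⱼ|)·(L/log 2 + 2)`.** [cite: Nesterenko2003, §4.2 (4.23); shape only] -/
theorem Xb3R_real_le (I : ℕ) :
    (S.Xb3R P I : ℝ) ≤ 1 + (|(S.bθ : ℝ)| * S.d + ∑ j, |(S.b j : ℝ)|) * ((P.L : ℝ) / Real.log 2 + 2) := by
  have hlog2 : (0 : ℝ) < Real.log 2 := Real.log_pos (by norm_num)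
  have hL : (0 : ℝ) ≤ P.L := by positivity
  -- every box is `≤ L/log 2 + 2`
  have hB : ∀ (A : ℝ), Real.log 2 ≤ A → ∀ I : ℕ, 2 * ((P.L : ℝ) / (2 * A) + 1) / 3 ^ I ≤ (P.L : ℝ) / Real.log 2 + 2 := by
    intro A hA I
    have hApos : 0 < A := hlog2.trans_le hA
    have h3 : (1 : ℝ) ≤ 3 ^ I := one_le_pow₀ (by norm_num)
    have hnum : 0 ≤ 2 * ((P.L : ℝ) / (2 * A) + 1) := by positivity
    calc 2 * ((P.L : ℝ) / (2 * A) + 1) / 3 ^ I ≤ 2 * ((P.L : ℝ) / (2 * A) + 1) := div_le_self hnum h3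
      _ = (P.L : ℝ) / A + 2 := by field_simp
      _ ≤ (P.L : ℝ) / Real.log 2 + 2 := by
          have := div_le_div_of_nonneg_left hL hlog2 hA
          linarith
  have hbox : ∀ j, (S.Dbox3R P I j : ℝ) ≤ (P.L : ℝ) / Real.log 2 + 2 :=
    fun j => (S.Dbox3R_real_le P I j).trans (hB _ (P.hA _) I)
  have hθbox : (S.Dθ3R P I : ℝ) ≤ (P.L : ℝ) / Real.log 2 + 2 := (S.Dθ3R_real_le P I).trans (hB _ (P.hA _) I)
  unfold Xb3R
  push_cast
  have h1 : |(S.bθ : ℝ)| * ∑ j, (S.Dbox3R P I j : ℝ) ≤ |(S.bθ : ℝ)| * (S.d * ((P.L : ℝ) / Real.log 2 + 2)) := by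
    refine mul_le_mul_of_nonneg_left ?_ (abs_nonneg _)
    have := Finset.sum_le_sum fun j (_ : j ∈ (Finset.univ : Finset (Fin S.d))) => hbox j
    rw [Finset.sum_const, Finset.card_univ, Fintype.card_fin, nsmul_eq_mul] at this
    exact this
  have h2 : (∑ j, |(S.b j : ℝ)|) * (S.Dθ3R P I : ℝ) ≤ (∑ j, |(S.b j : ℝ)|) * ((P.L : ℝ) / Real.log 2 + 2) :=
    mul_le_mul_of_nonneg_left hθbox (Finset.sum_nonneg fun _ _ => abs_nonneg _)
  nlinarith [h1, h2]

/-- **`log #box ≤ log(L₀+1) + (d+1)·log(L/log 2 + 3)`.** [folklore] -/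
theorem log_cardB_schedTwoS_le' (I : ℕ) :
    Real.log ((S.schedTwoS P).cardB I : ℝ) ≤
      Real.log ((P.L₀ + 1 : ℕ) : ℝ) + (S.d + 1) * Real.log ((P.L : ℝ) / Real.log 2 + 3) := by
  rw [S.log_cardB_schedTwoS P I]
  have hlog2 : (0 : ℝ) < Real.log 2 := Real.log_pos (by norm_num)
  have hL : (0 : ℝ) ≤ P.L := by positivity
  have hside : ∀ (A : ℝ), Real.log 2 ≤ A → ∀ (D : ℕ), (D : ℝ) ≤ (P.L : ℝ) / (2 * A) + 1 →
      Real.log ((2 * D + 1 : ℕ) : ℝ) ≤ Real.log ((P.L : ℝ) / Real.log 2 + 3) := by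
    intro A hA D hD
    have hApos : 0 < A := hlog2.trans_le hA
    refine Real.log_le_log (by positivity) ?_
    push_cast
    have : (P.L : ℝ) / A ≤ (P.L : ℝ) / Real.log 2 := div_le_div_of_nonneg_left hL hlog2 hA
    have e : 2 * ((P.L : ℝ) / (2 * A)) = (P.L : ℝ) / A := by field_simp
    nlinarith
  have h1 : ∑ j, Real.log ((2 * S.Dbox3 P 0 j + 1 : ℕ) : ℝ) ≤ ∑ j : Fin S.d, Real.log ((P.L : ℝ) / Real.log 2 + 3) :=
    Finset.sum_le_sum fun j _ => hside _ (P.hA _) _ (S.Dbox3_zero_real_le P j)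
  have h2 := hside _ (P.hA _) _ (S.Dθ3_zero_real_le P)
  rw [Finset.sum_const, Finset.card_univ, Fintype.card_fin, nsmul_eq_mul] at h1
  linarith

end TwoSetup

end Summit.ABC.StewartYu

end
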